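import Literature.NumberTheory.GaloisRepresentations.LocalReciprocityConjEquivariance
import Literature.NumberTheory.GaloisRepresentations.LocalReciprocityThetaProofs
import Literature.NumberTheory.GaloisRepresentations.LocalWeilDatumNorm
import Literature.NumberTheory.GaloisRepresentations.LocalClassFieldTheoryProofs
import Literature.NumberTheory.GaloisRepresentations.LocalFieldFiniteExtension
import Literature.NumberTheory.GaloisRepresentations.LocalFieldPadicProofs
import Literature.AnabelianGeometry.AbsoluteAnabelian.LocalInertiaTorsionFreeProofs
import Literature.AnabelianGeometry.AbsoluteAnabelian.MLFGaloisGroupsProofs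
import Literature.AnabelianGeometry.AbsoluteAnabelian.MLFReciprocityInputs
import HarnessLib

/-!
# Discharge of `mlf_reciprocity_equivariant` ([AbsAnab] §1.2 p. 9 / Prop 1.2.1 (iv), (vi):
# the reciprocity map of a finite Galois subextension and its `G_K`-equivariance)

S. Mochizuki, *The Absolute Anabelian Geometry of Hyperbolic Curves* (2004) [AbsAnab], §1.2: for an
MLF `K` and a finite Galois subextension `E ⊆ K̄`, local class field theory gives
`Art_E : E^× → G_E^{ab}`, injective with image containing the torsion, and compatible with the action
of `G_K` (functoriality of the norm residue symbol under field isomorphisms, Neukirch, *Algebraic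
Number Theory* IV (5.8)).  The named fact `mlf_reciprocity_equivariant` (`MLFReciprocityInputs.lean`,
abc-iut-L4-t11) records exactly this; this file PROVES it (`mlf_reciprocity_equivariant_holds`)
from the tree's local class field theory:

* §4 `mem_reps_of_absGaloisRestrict_eq_conj`, `absGaloisAbProj_eq_theta_of_conj`: for the
  reciprocity system `ω = recSystemE` of the local field `E` read in the Weil datum of `F`
  (`LocalReciprocityNormFunctoriality`) and its limit `θ_E = ω.theta`
  (`LocalReciprocityLimitProofs`), `[σ] = θ_E x ⟹ [σ'] = θ_E (γ x)` whenever
  `res σ' = ρ̂ · res σ · ρ̂⁻¹` (`ρ ∈ W_F`, `γ = ρ̂|_E`) — from the finite-level equivariance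
  `recSystemE_semilinearImage` (`LocalReciprocityConjEquivariance`), permuting the finite abelian
  `L' ⊆ Ē` by `φ_ρ`;
* §5 `exists_reciprocity_equivariant_embField`: `Art : E₀ˣ → Gal(F̄/E₀)^ab` for `E₀ = ι⁻¹(E) ⊆ F̄`,
  namely `θ_E` transported along `Gal(F̄/E₀) ≅ Γ_E` (`exists_continuousMulEquiv_galFixing_embField`,
  `exists_mulEquiv_topologicalAbelianization`); injective and with the torsion in its image by
  `IsLocalReciprocityMap` (`θ_E(U_E) = [I_E]`, `[Γ_E, Γ_E]⁻ ≤ I_E`, `Γ_E/I_E` torsion-free —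
  `mem_absInertia_of_pow_mem`); `Γ_F`-equivariant by §4 and the density of `W_F` in `Γ_F`
  (`g = ρ̂ k` with `k ∈ Gal(F̄/E₀)`, which acts trivially on `E₀` and innerly on `Gal(F̄/E₀)^ab`);
* §6 the `ℚ_p`-binder model: `E ⊆ K̄` normal is its own `ι⁻¹(E)` (`embField_eq_self`), and `K`, `E`
  carry the local-field structures of `LocalFieldFiniteExtension` / `LocalFieldPadicProofs`.

No definitions, no named facts; classical LCFT only.  HONEST FRAMING: no bearing on [IUTchIII]
Cor. 3.12.  References: Neukirch, *ANT* IV (5.8) [NeukirchANT1999]; [AbsAnab] §1.2 p. 9, p. 11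
[MochizukiAbsAnab2004].
-/

noncomputable section

open Field IsNonarchimedeanLocalField ValuativeRel
open scoped Pointwise

namespace Literature.AnabelianGeometry.AbsoluteAnabelian

open Literature.NumberTheory.GaloisRepresentations
open Literature.NumberTheory.GaloisRepresentations.LocalWeilDatum
open AbstractCFT AbstractCFT.WeilDatum

/-! ### §4 Transport of representatives and of `θ_E` -/

section Theta

variable {F E : Type*} [Field F] [ValuativeRel F] [TopologicalSpace F] [IsNonarchimedeanLocalField F]
  [Field E] [Algebra F E] [FiniteDimensional F E] [Algebra.IsSeparable F E] [Normal F E]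
  [ValuativeRel E] [TopologicalSpace E] [IsNonarchimedeanLocalField E] [ValuativeExtension F E]

/-- **Representatives transport**: if `σ ∈ Γ_E` represents `(x, */E)` (i.e. `σ|_{L'} = (x, L'/E)`
for every finite abelian `L'`) and `res σ' = ρ · res σ · ρ⁻¹` in `Γ_F` (`ρ ∈ W_F`), then `σ'`
represents `(γ x, */E)`, `γ = ρ|_E`. [cite: NeukirchANT1999, Ch. IV Prop. (5.8)] -/
theorem mem_reps_of_absGaloisRestrict_eq_conj (hcf : (localWeilDatum F).IsClassFieldTheory)
    (ρ : WeilGroup F) {φ : AlgebraicClosure E ≃+* AlgebraicClosure E}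
    (hφι : ∀ a, φ (absClosureEmbedding F E a) = absClosureEmbedding F E (WeilGroup.toAbsGalois F ρ • a))
    {γ : E ≃+* E}
    (hφ : ∀ x : E, φ (algebraMap E (AlgebraicClosure E) x) = algebraMap E (AlgebraicClosure E) (γ x))
    (x : Eˣ) {σ σ' : absoluteGaloisGroup E}
    (hσ' : absGaloisRestrict F E σ' =
      WeilGroup.toAbsGalois F ρ * absGaloisRestrict F E σ * (WeilGroup.toAbsGalois F ρ)⁻¹)
    (hσ : σ ∈ (isReciprocitySystemE (F := F) (E := E) hcf).Reps x) :
    σ' ∈ (isReciprocitySystemE (F := F) (E := E) hcf).Reps (Units.map (γ : E →* E) x) := by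
  intro M _ _
  -- `L' = φ⁻¹ M`, a finite abelian extension of `E` with `φ L' = M`
  have hφ' : ∀ y : E, φ.symm (algebraMap E (AlgebraicClosure E) y) =
      algebraMap E (AlgebraicClosure E) (γ.symm y) := fun y => by
    rw [RingEquiv.symm_apply_eq, hφ, RingEquiv.apply_symm_apply]
  obtain ⟨L', hL'⟩ := exists_intermediateField_semilinearImage hφ' M
  have hM : ∀ z, z ∈ M ↔ φ.symm z ∈ L' := fun z => by
    rw [hL', RingEquiv.symm_symm, RingEquiv.apply_symm_apply]
  haveI := finiteDimensional_semilinearImage hφ' hL'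
  haveI := isAbelianGalois_semilinearImage hφ' hL'
  -- `σ|_{L'} = (x, L'/E) = w|_{L'}` for some `w ∈ U_E`
  obtain ⟨w, hw⟩ := weilRestrictE_surjective F E L' (recSystemE hcf L' x)
  have h1 : AlgEquiv.restrictNormalHom L' (absoluteGaloisGroup.toAlgEquiv E σ) =
      AlgEquiv.restrictNormalHom L' (absoluteGaloisGroup.toAlgEquiv E
        (liftGal F E ((toAbsGalois_mem_galFixing_iff (F := F)).mpr w.2))) := by
    rw [hσ L', ← hw, weilRestrictE_apply]
  -- finite-level equivariance: `(γ x, M/E) = (ρ w ρ⁻¹)|_M`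
  rw [recSystemE_semilinearImage hcf ρ hφι hφ hM x w hw.symm, weilRestrictE_apply]
  refine restrictNormalHom_eq_of_semilinear_conj hM
    (smul_map_of_absGaloisRestrict_eq_conj F E hφι hσ')
    (smul_map_of_absGaloisRestrict_eq_conj F E hφι ?_) h1
  rw [absGaloisRestrict_liftGal, absGaloisRestrict_liftGal]
  simp only [map_mul, map_inv]

/-- **Equivariance of `θ_E` under `W_F`-conjugation**: `[σ] = θ_E x` implies
`[σ'] = θ_E (γ x)` whenever `res σ' = ρ · res σ · ρ⁻¹`, `γ = ρ|_E` (`ρ ∈ W_F`).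
[cite: NeukirchANT1999, Ch. IV Prop. (5.8)] -/
theorem absGaloisAbProj_eq_theta_of_conj (hcf : (localWeilDatum F).IsClassFieldTheory)
    (ρ : WeilGroup F) {φ : AlgebraicClosure E ≃+* AlgebraicClosure E}
    (hφι : ∀ a, φ (absClosureEmbedding F E a) = absClosureEmbedding F E (WeilGroup.toAbsGalois F ρ • a))
    {γ : E ≃+* E}
    (hφ : ∀ x : E, φ (algebraMap E (AlgebraicClosure E) x) = algebraMap E (AlgebraicClosure E) (γ x))
    (x : Eˣ) {σ σ' : absoluteGaloisGroup E}
    (hσ' : absGaloisRestrict F E σ' =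
      WeilGroup.toAbsGalois F ρ * absGaloisRestrict F E σ * (WeilGroup.toAbsGalois F ρ)⁻¹)
    (h : absGaloisAbProj E σ = (isReciprocitySystemE (F := F) (E := E) hcf).theta x) :
    absGaloisAbProj E σ' =
      (isReciprocitySystemE (F := F) (E := E) hcf).theta (Units.map (γ : E →* E) x) :=
  (isReciprocitySystemE (F := F) (E := E) hcf).absGaloisAbProj_eq_theta_iff.mpr
    (mem_reps_of_absGaloisRestrict_eq_conj hcf ρ hφι hφ x hσ'
      ((isReciprocitySystemE (F := F) (E := E) hcf).absGaloisAbProj_eq_theta_iff.mp h))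

end Theta

/-! ### §5 The reciprocity map of `E₀ ⊆ F̄` with values in `G_{E₀}^ab ≤ Γ_F^ab`, `Γ_F`-equivariant -/

section Iso

variable (F E : Type*) [Field F] [Field E] [Algebra F E] [Algebra.IsAlgebraic F E]

/-- **`G_{E₀} ≅ Γ_E` as topological groups** (`G_{E₀} = Gal(F̄/E₀) ≤ Γ_F` with the Krull topology
of `Γ_F`): the lift `liftGalHom` along `ι : F̄ ≅ Ē`, whose inverse `res` is a continuous bijection
from the compact `Γ_E` onto the Hausdorff `G_{E₀}`. [cite: TateCorvallis1979, (1.4.5)] -/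
theorem exists_continuousMulEquiv_galFixing_embField :
    ∃ Φ : galFixing F (embField F E) ≃ₜ* absoluteGaloisGroup E,
      ∀ h : galFixing F (embField F E), Φ h = liftGal F E h.2 := by
  haveI : CompactSpace (absoluteGaloisGroup E) := absoluteGaloisGroup_compactSpace E
  let e : absoluteGaloisGroup E ≃ galFixing F (embField F E) :=
    { toFun := fun σ => ⟨absGaloisRestrict F E σ, absGaloisRestrict_mem_galFixing F E σ⟩
      invFun := fun h => liftGal F E h.2
      left_inv := fun σ => liftGal_absGaloisRestrict F E σ _
      right_inv := fun h => Subtype.ext (absGaloisRestrict_liftGal F E h.2) }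
  have he : Continuous e := (absGaloisRestrict F E).continuous.subtype_mk _
  let eₜ : absoluteGaloisGroup E ≃ₜ galFixing F (embField F E) := he.homeoOfEquivCompactToT2 (f := e)
  exact ⟨{ toEquiv := e.symm
           map_mul' := fun a b => (liftGalHom F E).map_mul a b
           continuous_toFun := eₜ.symm.continuous
           continuous_invFun := eₜ.continuous }, fun _ => rfl⟩

end Iso

section Package

variable (F E : Type*) [Field F] [ValuativeRel F] [TopologicalSpace F] [IsNonarchimedeanLocalField F]
  [Field E] [Algebra F E] [FiniteDimensional F E] [Algebra.IsSeparable F E] [Normal F E]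
  [ValuativeRel E] [TopologicalSpace E] [IsNonarchimedeanLocalField E] [ValuativeExtension F E]

/-- **The reciprocity map of the finite Galois subextension `E₀ = ι⁻¹(E) ⊆ F̄`, with values in
`Gal(F̄/E₀)^ab` and its `Γ_F`-equivariance** (Neukirch IV (5.8), functoriality of the norm residue
symbol under `σ : L|K → σL|σK`, here for the inner automorphisms of `Γ_F`): there is a homomorphism
`Art : E₀ˣ → Gal(F̄/E₀)^ab` which is injective, whose image contains every torsion element, and
such that `Art (g u) = g̃ Art(u) g̃⁻¹` for `g ∈ Γ_F` — stated relationally: if `u' = g • u` and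
`h' = g h g⁻¹` then `Art u = [h] → Art u' = [h']`.  `Art` is Serre's `θ_E` (read inside the Weil
datum of `F`, `recSystemE`) transported along `Gal(F̄/E₀) ≅ Γ_E`; injectivity and the torsion clause
are `IsLocalReciprocityMap` (`θ_E(U_E) = [I_E] ⊇` torsion, as `Γ_E/I_E ≅ Ẑ` is torsion-free and
`[Γ_E,Γ_E]⁻ ≤ I_E`); equivariance is `absGaloisAbProj_eq_theta_of_conj` for `ρ ∈ W_F` plus density
of `W_F` in `Γ_F` (`g = ρ k`, `k ∈ G_{E₀}` acts trivially on `E₀` and by an inner automorphism on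
`Gal(F̄/E₀)^ab`). [cite: NeukirchANT1999, Ch. IV Prop. (5.8)] -/
theorem exists_reciprocity_equivariant_embField :
    ∃ Art : (embField F E)ˣ →* TopologicalAbelianization (galFixing F (embField F E)),
      Function.Injective Art ∧
      (∀ t, IsOfFinOrder t → t ∈ Set.range Art) ∧
      ∀ (g : absoluteGaloisGroup F) (u u' : (embField F E)ˣ) (h h' : galFixing F (embField F E)),
        ((u' : embField F E) : AlgebraicClosure F) = g • ((u : embField F E) : AlgebraicClosure F) →
        (h' : absoluteGaloisGroup F) = g * h * g⁻¹ →
        Art u = QuotientGroup.mk h → Art u' = QuotientGroup.mk h' := by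
  classical
  set hcf := isClassFieldTheory_localWeilDatum F
  set hω := isReciprocitySystemE (F := F) (E := E) hcf
  have hθ : IsLocalReciprocityMap E hω.theta :=
    hω.isLocalReciprocityMap_theta (universalNormSubgroup_eq_bot E) (isClosed_of_isNormSubgroup_holds E)
  obtain ⟨Φ, hΦ⟩ := exists_continuousMulEquiv_galFixing_embField F E
  obtain ⟨ê, hê⟩ := exists_mulEquiv_topologicalAbelianization Φ
  let eE : E ≃ₐ[F] embField F E := equivEmbField F E
  let Art : (embField F E)ˣ →* TopologicalAbelianization (galFixing F (embField F E)) :=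
    ê.symm.toMonoidHom.comp (hω.theta.comp (Units.map (eE.symm : embField F E →* E)))
  have hArt : ∀ u, Art u = ê.symm (hω.theta (Units.map (eE.symm : embField F E →* E) u)) := fun _ => rfl
  -- `Art u = [h] ↔ θ (ι u) = [liftGal h]`
  have hArt_eq : ∀ (u : (embField F E)ˣ) (h : galFixing F (embField F E)),
      Art u = QuotientGroup.mk h ↔
        absGaloisAbProj E (liftGal F E h.2) = hω.theta (Units.map (eE.symm : embField F E →* E) u) := by
    intro u h
    rw [hArt, MulEquiv.symm_apply_eq, hê, hΦ, eq_comm]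
    exact Iff.rfl
  refine ⟨Art, ?_, ?_, ?_⟩
  · -- injective
    intro u v huv
    rw [hArt, hArt] at huv
    have h1 := hθ.injective (ê.symm.injective huv)
    have h2 : (Units.map (eE.symm : embField F E →* E)) u = (Units.map (eE.symm : embField F E →* E)) v := h1
    exact (Units.map_injective (f := (eE.symm : embField F E →* E)) eE.symm.injective) h2
  · -- torsion elements are in the range: they come from `[I_E] = θ(U_E)`
    intro t ht
    obtain ⟨n, hn, htn⟩ := isOfFinOrder_iff_pow_eq_one.mp ht
    have hCI : (commutator (absoluteGaloisGroup E)).topologicalClosure ≤ absInertia E :=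
      WeilGroup.topologicalClosure_commutator_absGalois_le_absInertia
        (WeilGroup.denseRange_toAbsGalois_holds E)
    obtain ⟨σ, hσ⟩ := QuotientGroup.mk_surjective (ê t)
    have hσn : σ ^ n ∈ absInertia E := by
      apply hCI
      rw [← QuotientGroup.eq_one_iff, QuotientGroup.mk_pow, hσ, ← map_pow, htn, map_one]
    have hσI : σ ∈ absInertia E := mem_absInertia_of_pow_mem hn hσn
    have hmem : (QuotientGroup.mk σ : absoluteGaloisGroupAbelianization E) ∈
        ((absInertia E).map (absGaloisAbProj E)) := ⟨σ, hσI, rfl⟩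
    rw [← hθ.map_unitGroup] at hmem
    obtain ⟨v, -, hv⟩ := hmem
    refine ⟨Units.map (eE : E →* embField F E) v, ?_⟩
    rw [hArt, MulEquiv.symm_apply_eq, ← hσ, ← hv]
    congr 1
    ext
    simp [eE]
  · -- equivariance
    intro g u u' h h' hu hh' hArt_u
    haveI := finiteDimensional_embField F E
    -- density: `ρ̂ = g k` with `ρ ∈ W_F`, `k ∈ G_{E₀}`
    obtain ⟨ρ, hρ⟩ := exists_toAbsGalois_mem_smul_galFixing F (embField F E) g
    obtain ⟨k, hk, hgk⟩ := Set.mem_smul_set.mp hρ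
    rw [smul_eq_mul] at hgk
    -- replace `h` by `k⁻¹ h k` (same class in the abelianisation) and `g` by `ρ̂ = g k`
    let h₁ : galFixing F (embField F E) := ⟨k⁻¹ * h * k, mul_mem (mul_mem (inv_mem hk) h.2) hk⟩
    have hcls : (QuotientGroup.mk h : TopologicalAbelianization (galFixing F (embField F E))) =
        QuotientGroup.mk h₁ := by
      have : h₁ = (⟨k, hk⟩ : galFixing F (embField F E))⁻¹ * h * ⟨k, hk⟩ := Subtype.ext rfl
      rw [this, QuotientGroup.mk_mul, QuotientGroup.mk_mul, QuotientGroup.mk_inv, inv_mul_cancel_comm]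
    have hu' : ((u' : embField F E) : AlgebraicClosure F) =
        WeilGroup.toAbsGalois F ρ • ((u : embField F E) : AlgebraicClosure F) := by
      rw [hu, ← hgk, mul_smul, (mem_galFixing_iff F).mp hk _ (u : embField F E).2]
    have hh₁' : (h' : absoluteGaloisGroup F) =
        WeilGroup.toAbsGalois F ρ * h₁ * (WeilGroup.toAbsGalois F ρ)⁻¹ := by
      change (h' : absoluteGaloisGroup F) =
        WeilGroup.toAbsGalois F ρ * (k⁻¹ * h * k) * (WeilGroup.toAbsGalois F ρ)⁻¹
      rw [hh', ← hgk]
      group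
    rw [hcls] at hArt_u
    -- the conjugation data of `ρ̂`
    obtain ⟨φ, hφι⟩ := exists_ringEquiv_conj_absClosureEmbedding F E (WeilGroup.toAbsGalois F ρ)
    obtain ⟨γ, hφ⟩ := exists_ringEquiv_semilinear F E hφι
    -- `ι u' = γ (ι u)` in `E`
    have hγu : Units.map (eE.symm : embField F E →* E) u' =
        Units.map (γ : E →* E) (Units.map (eE.symm : embField F E →* E) u) := by
      ext
      apply (algebraMap E (AlgebraicClosure E)).injective
      change algebraMap E (AlgebraicClosure E) (eE.symm (u' : embField F E)) =
        algebraMap E (AlgebraicClosure E) (γ (eE.symm (u : embField F E)))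
      rw [← hφ, ← absClosureEmbedding_coe_eq, ← absClosureEmbedding_coe_eq, hu', hφι]
    -- apply the `W_F`-equivariance of `θ_E`
    have hmem' : WeilGroup.toAbsGalois F ρ * (h₁ : absoluteGaloisGroup F) * (WeilGroup.toAbsGalois F ρ)⁻¹ ∈
        galFixing F (embField F E) := conj_mem_galFixing F E _ h₁.2
    have key := absGaloisAbProj_eq_theta_of_conj hcf ρ hφι hφ
      (Units.map (eE.symm : embField F E →* E) u) (σ := liftGal F E h₁.2) (σ' := liftGal F E hmem')
      (absGaloisRestrict_liftGal_conj F E _ h₁.2 hmem') ((hArt_eq u h₁).mp hArt_u)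
    have hh'eq : h' = ⟨_, hmem'⟩ := Subtype.ext hh₁'
    rw [hh'eq, hArt_eq, hγu]
    exact key

end Package

/-! ### §6 The `ℚ_p`-binder model: `mlf_reciprocity_equivariant` -/

section Model

/-- For a normal intermediate field `E` of `K̄/K`, the copy `ι⁻¹(E) ⊆ K̄` of `E` used by the Weil
datum (`embField K E`, `ι : K̄ ≅ Ē` the chosen `K`-embedding) is `E` itself. [folklore] -/
private theorem embField_eq_self {K : Type*} [Field K] (E : IntermediateField K (AlgebraicClosure K))
    [Normal K E] : embField K E = E := by
  ext a
  rw [mem_embField_iff]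
  constructor
  · rintro ⟨y, hy⟩
    obtain ⟨x, rfl⟩ := ((absClosureEmbedding K E).restrictNormal' E).surjective y
    have hx : algebraMap E (AlgebraicClosure E) ((absClosureEmbedding K E).restrictNormal' E x) =
        absClosureEmbedding K E (x : AlgebraicClosure K) :=
      (absClosureEmbedding K E).restrictNormal_commutes E x
    rw [hx] at hy
    rw [← (absClosureEmbedding K E).injective hy]
    exact x.2
  · intro ha
    exact ⟨(absClosureEmbedding K E).restrictNormal' E ⟨a, ha⟩,
      (absClosureEmbedding K E).restrictNormal_commutes E ⟨a, ha⟩⟩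

/-- **`mlf_reciprocity_equivariant` holds** ([AbsAnab] §1.2 p. 9, the LCFT input used on p. 11 for
Prop 1.2.1 (iv), (vi)): for an MLF `K/ℚ_p` and a finite Galois subextension `E ⊆ K̄`, the
reciprocity map `Art_E : E^× → Gal(K̄/E)^ab` is injective, its image contains the torsion, and it
is `Gal(K̄/K)`-equivariant (`Art_E(g x) = g̃ Art_E(x) g̃⁻¹`).  Proof: `E` is a non-archimedean local
field (finite extension of the finite extension `K` of `ℚ_p`), and
`exists_reciprocity_equivariant_embField K E` (Serre's `θ_E` read in the Weil datum of `K`,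
conjugation-equivariance of Neukirch's reciprocity map) applies to `ι⁻¹(E) = E`
(`embField_eq_self`). [cite: MochizukiAbsAnab2004, Prop 1.2.1 (iv) proof p.11] -/
theorem mlf_reciprocity_equivariant_holds : mlf_reciprocity_equivariant := by
  intro p _ K _ _ _ E _ _
  haveI : IsNonarchimedeanLocalField ℚ_[p] := Padic.isNonarchimedeanLocalField_holds p
  letI := FiniteExtension.normedField ℚ_[p] K
  letI := FiniteExtension.valuativeRel ℚ_[p] K
  haveI : IsNonarchimedeanLocalField K := FiniteExtension.isNonarchimedeanLocalField ℚ_[p] K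
  letI := FiniteExtension.normedField K E
  letI := FiniteExtension.valuativeRel K E
  haveI : IsNonarchimedeanLocalField E := FiniteExtension.isNonarchimedeanLocalField K E
  haveI : ValuativeExtension K E := FiniteExtension.valuativeExtension K E
  have key := exists_reciprocity_equivariant_embField K E
  rw [embField_eq_self E] at key
  exact key

end Model

end Literature.AnabelianGeometry.AbsoluteAnabelian
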